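import Summits.QuantumFields.YangMills.Theorems.BalabanLadderIRTwistedSlabOrbitChartPhase
import Summits.QuantumFields.YangMills.Theorems.BalabanLadderIRTwistedSlabTubeWindow
import Literature.MeasureTheory.Group.HaarLocalChart
import HarnessLib

/-!
# Gauge-orbit data for the Laplace assembly on the twisted slab: the gauge group action (jointly continuous, Haar-preserving), the finite
# stabiliser `Z_N` of the twist-eating ladders (`hstab` ∕ `hfix`), the exponential gauge chart OPEN AT THE ORIGIN (`𝓝 1 ≤ map expGauge (𝓝 0)`),
# and the ladder background as a zero of the exponent — the problem-side inputs of lit-4's L17 §4 ∕ L18 ∕ L21 (∕ L23) BY NAME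

HELPER toward stub **T1** `TwistedSlabAnchor` (LINE `twisted-slab-continuity`, crux `IRcof` stmt-QuantumFields-26930, census row 43;
LEAD prover ym-ir-line-tsc-p1 g4; `--supports` the crux, `--as helper`).  Sequel of `…TwistedSlabOrbitChartPhase` (K18) and `…TwistedSlabTubeWindow` (K20a).
Proof file: theorems only, no definitions, no named facts.  Norm scope `Matrix.Norms.Frobenius` (Federbush's `star_mlog_of_mem_unitaryGroup`); every
conclusion is topological ∕ measure-theoretic ∕ algebraic (crosses norm scopes).
* §1 the action `gaugeAct` of the gauge group `𝒢 = (sites → SU(N))` on the link space `SU(N)^E`: ★ `continuous_gaugeAct_uncurry` (jointly continuous ⇒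
  `measurable_gaugeAct_uncurry` = lit-4 `hact`), `gaugeAct_one` (`hone`; `gaugeAct_mul` = `hmul` is K2), ★ `measurePreserving_gaugeAct(_of_isHaarMeasure)`
  (`hpres`: a gauge transformation is a left × right translation in the compact link group; Haar measures of compact groups are right invariant,
  `HaarLocalChart.isMulRightInvariant_of_isHaarMeasure`), `gaugeAct_const_of_mem_center` (constant central maps fix EVERY configuration).
* §2 the stabiliser set `S = {constant maps valued in ⟨ω^k·1⟩ = Z_N}`: `finite_constCenterGauge` (`(ω^k·1)^N = 1`), `suCenter_coe_injective` (distinct labels), ★ `gaugeAct_eq_self_of_mem_constCenterGauge`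
  (`hfix`, for all configurations), ★ `mem_constCenterGauge_of_gaugeAct_ladder_eq` (`hstab`, K2 `gaugeAct_ladder_pair_eq_self_iff_specialUnitary`).
* §3 the series logarithm near `1`: `mlog_one_eq_zero`, `continuousAt_mlog`, ★ `mlog_skew_traceless_of_mem_specialUnitaryGroup` (`log` of a special unitary
  matrix within `1/4` of `1` with `|tr log| < 2π` is in `𝔰𝔲(N)`: Federbush + Liouville `det e^X = e^{tr X}`).
* §4 the charts: `continuous_expGauge`, `expGauge_zero`, ★★ `nhds_one_le_map_expGauge` (the exponential gauge chart `φ ↦ e^{φ}` maps every neighbourhood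
  of `0 ∈ suFields` ONTO a neighbourhood of `1 ∈ 𝒢` — local inverse `k ↦ (x ↦ log k(x))`, `𝔰𝔲`-valued near `1`), `continuous_sliceCfg` (the transversal),
  `continuous_tubeMap` (`(k, y) ↦ k • σ(y)` jointly continuous).
* §5 the background: `ladderFieldPair_mem_specialUnitaryGroup`, ★ `mk_ladderFieldPair_eq_ladderConfig` (the `SU(N)`-valued configuration of the matrix
  ladder `ladderField ![A, B, ω^i•1, ω^j•1]` IS K2's `ladderConfig ![A, B, ω^i·1, ω^j·1]`), `sliceCfg_zero_eq_ladderConfig` (`σ 0 =` the ladder),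
  ★ `twistedExponent_ladderConfig_pair` (the ladder is a zero of the exponent, K9), `twistedExponent_fibredChartMap_prodFrame_zero_eq_zero`.
NOT here (honest scope): openness of the orbit map ∕ tubes and disjointness of the `N²` tubes (next file), the slice property itself (L17 §4 ∕ L23 consume
`hstab`, `hfix`, local injectivity K20a and §4), the L18 ∕ L21 call; anything uniform in `β` (M3); the cluster expansion (M4); T1-box 0∕1, T1 proper 0∕1.

HONEST FRAMING: topology ∕ measure plumbing on one box; nothing here bears on `IRcof`, `IR`, or the Yang–Mills mass gap (Clay: NOT proved); R4 =
`BalabanLadder.UV` only.  References: G. E. Bredon, *Introduction to Compact Transformation Groups* (1972) Ch. II §§4–5; S. Helgason, *Groups and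
Geometric Analysis* Ch. I §1 Thm 1.14; A. González-Arroyo, *Yang–Mills fields on the four-dimensional torus* (1998) §4.2.
-/

set_option autoImplicit false

noncomputable section

open scoped Matrix Matrix.Norms.Frobenius Topology ENNReal Pointwise
open MeasureTheory Filter NormedSpace Set
open Literature.MathematicalPhysics.QuantumFieldTheory Literature.MathematicalPhysics.QuantumLattice
open Literature.MathematicalPhysics.QuantumFieldTheory.Balaban1983to89.MatrixLog (mlog exp_mlog analyticAt_mlog)
open Literature.MathematicalPhysics.QuantumFieldTheory.Balaban1983to89.B7BlockAvgLog (mlog_exp)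
open Literature.MathematicalPhysics.QuantumFieldTheory.Federbush1986.UNGauss (star_mlog_of_mem_unitaryGroup)
open Literature.Analysis.Matrix (det_exp_eq_exp_trace)

namespace Summit.QuantumFields.YangMills.Cruxes.IRcof.TwistedSlab

variable {N : ℕ} {n₀ n₁ n₂ n₃ : ℕ}

/-! ## §1 The gauge action: joint continuity, measurability, Haar preservation -/

section Action

/-- ★ **The gauge action `(g, U) ↦ g • U` is jointly continuous** (finite products in the compact group `SU(N)`).
[cite: Bredon1972, Ch. II §§4–5] -/
theorem continuous_gaugeAct_uncurry :
    Continuous fun p : (FinTorusSite n₀ n₁ n₂ n₃ → Matrix.specialUnitaryGroup (Fin N) ℂ) ×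
      (FinTorusSite n₀ n₁ n₂ n₃ × Fin 4 → Matrix.specialUnitaryGroup (Fin N) ℂ) => gaugeAct p.1 p.2 := by
  refine continuous_pi fun e => ?_
  simp only [gaugeAct]
  exact ((((continuous_apply e.1).comp continuous_fst).mul ((continuous_apply e).comp continuous_snd)).mul
    (((continuous_apply (e.1.shift e.2)).comp continuous_fst).inv))

/-- The gauge action is jointly measurable (lit-4 L17 ∕ L18 `hact`). [cite: Bredon1972, Ch. II §§4–5] -/
theorem measurable_gaugeAct_uncurry :
    Measurable fun p : (FinTorusSite n₀ n₁ n₂ n₃ → Matrix.specialUnitaryGroup (Fin N) ℂ) ×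
      (FinTorusSite n₀ n₁ n₂ n₃ × Fin 4 → Matrix.specialUnitaryGroup (Fin N) ℂ) => gaugeAct p.1 p.2 :=
  continuous_gaugeAct_uncurry.measurable

/-- Each gauge transformation is a continuous map of configurations. [folklore] -/
theorem continuous_gaugeAct (g : FinTorusSite n₀ n₁ n₂ n₃ → Matrix.specialUnitaryGroup (Fin N) ℂ) :
    Continuous (gaugeAct g : (FinTorusSite n₀ n₁ n₂ n₃ × Fin 4 → Matrix.specialUnitaryGroup (Fin N) ℂ) →
      (FinTorusSite n₀ n₁ n₂ n₃ × Fin 4 → Matrix.specialUnitaryGroup (Fin N) ℂ)) := by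
  refine continuous_pi fun e => ?_
  simp only [gaugeAct]
  exact ((continuous_const.mul (continuous_apply e)).mul continuous_const)

/-- `1 • U = U` (lit-4 `hone`; `hmul` is K2's `gaugeAct_mul`). [folklore] -/
theorem gaugeAct_one (U : FinTorusSite n₀ n₁ n₂ n₃ × Fin 4 → Matrix.specialUnitaryGroup (Fin N) ℂ) :
    gaugeAct (1 : FinTorusSite n₀ n₁ n₂ n₃ → Matrix.specialUnitaryGroup (Fin N) ℂ) U = U :=
  gaugeAct_one' U

/-- ★ **Gauge transformations preserve every bi-invariant measure on the link group**: `g • U = a·U·b` with `a(x,μ) = g(x)`, `b(x,μ) = g(x+e_μ)⁻¹`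
(a left and a right translation in `SU(N)^E`; lit-4 `hpres`). [cite: Bredon1972, Ch. II §§4–5] -/
theorem measurePreserving_gaugeAct (g : FinTorusSite n₀ n₁ n₂ n₃ → Matrix.specialUnitaryGroup (Fin N) ℂ)
    (μ : Measure (FinTorusSite n₀ n₁ n₂ n₃ × Fin 4 → Matrix.specialUnitaryGroup (Fin N) ℂ)) [μ.IsMulLeftInvariant] [μ.IsMulRightInvariant] :
    MeasurePreserving (gaugeAct g) μ μ := by
  have h : gaugeAct g = (fun U : FinTorusSite n₀ n₁ n₂ n₃ × Fin 4 → Matrix.specialUnitaryGroup (Fin N) ℂ =>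
      U * fun e => (g (e.1.shift e.2))⁻¹) ∘ fun U => (fun e => g e.1) * U := by
    funext U e; rfl
  rw [h]
  exact (measurePreserving_mul_right μ _).comp (measurePreserving_mul_left μ _)

/-- ★ Gauge transformations preserve every Haar measure on the link group (in particular the product Haar probability of K9's `rfl` link).
[cite: Bredon1972, Ch. II §§4–5] -/
theorem measurePreserving_gaugeAct_of_isHaarMeasure (g : FinTorusSite n₀ n₁ n₂ n₃ → Matrix.specialUnitaryGroup (Fin N) ℂ)
    (μ : Measure (FinTorusSite n₀ n₁ n₂ n₃ × Fin 4 → Matrix.specialUnitaryGroup (Fin N) ℂ)) [μ.IsHaarMeasure] :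
    MeasurePreserving (gaugeAct g) μ μ := by
  haveI := Literature.MeasureTheory.Group.HaarLocalChart.isMulRightInvariant_of_isHaarMeasure μ
  exact measurePreserving_gaugeAct g μ

/-- **Constant central gauge maps act trivially on EVERY configuration.** [folklore] -/
theorem gaugeAct_const_of_mem_center {G : Type*} [Group G] {c : G} (hc : c ∈ Subgroup.center G)
    (U : FinTorusSite n₀ n₁ n₂ n₃ × Fin 4 → G) : gaugeAct (fun _ : FinTorusSite n₀ n₁ n₂ n₃ => c) U = U := by
  funext e
  rw [gaugeAct, ← Subgroup.mem_center_iff.mp hc (U e), mul_inv_cancel_right]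

end Action

/-! ## §2 The stabiliser set `S`: constant gauge maps valued in `Z_N = ⟨ω^k·1⟩` -/

section Stabiliser

variable {m₀ m₁ m₂ m₃ : ℕ}

/-- `(ω^k·1)^N = 1` in `SU(N)` (lit-4 `suCenter_pow_card`, coerced). [folklore] -/
theorem coe_suCenter_pow_card [NeZero N] (k : ZMod N) : ((suCenter N k : Matrix.specialUnitaryGroup (Fin N) ℂ)) ^ N = 1 := by
  rw [← Subgroup.coe_pow, Literature.MathematicalPhysics.QuantumLattice.suCenter_pow_card N k, Subgroup.coe_one]

/-- The centre phases `ω^k`, `k ∈ ℤ/N`, are pairwise distinct. [folklore] -/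
theorem centerPhase_injective [NeZero N] : Function.Injective (centerPhase N) := by
  intro k k' h
  rw [centerPhase_eq_exp_pow, centerPhase_eq_exp_pow] at h
  exact ZMod.val_injective N ((Complex.isPrimitiveRoot_exp N (NeZero.ne N)).pow_inj (ZMod.val_lt k) (ZMod.val_lt k') h)

/-- The centre elements `ω^k·1 ∈ SU(N)`, `k ∈ ℤ/N`, are pairwise distinct (so the `N²` decorated ladders have pairwise distinct orbits). [folklore] -/
theorem suCenter_coe_injective [NeZero N] : Function.Injective fun k : ZMod N => (suCenter N k : Matrix.specialUnitaryGroup (Fin N) ℂ) := by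
  intro k k' h
  have h1 := congrArg (fun g : Matrix.specialUnitaryGroup (Fin N) ℂ => (g : Matrix (Fin N) (Fin N) ℂ) 0 0) h
  simp only [coe_suCenter, Matrix.smul_apply, Matrix.one_apply_eq, smul_eq_mul, mul_one] at h1
  exact centerPhase_injective h1

/-- The cyclic group `⟨ω^k·1⟩ ≤ SU(N)` is finite. [folklore] -/
theorem finite_zpowers_suCenter [NeZero N] (k : ZMod N) :
    ((Subgroup.zpowers (suCenter N k : Matrix.specialUnitaryGroup (Fin N) ℂ)) : Set (Matrix.specialUnitaryGroup (Fin N) ℂ)).Finite :=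
  (isOfFinOrder_iff_pow_eq_one.mpr ⟨N, Nat.pos_of_ne_zero (NeZero.ne N), coe_suCenter_pow_card k⟩).finite_zpowers

/-- **The stabiliser set `S` — constant gauge maps valued in `⟨ω^k·1⟩` — is finite.** [cite: Gonzalezarroyo1998, §4.2] -/
theorem finite_constCenterGauge [NeZero N] (k : ZMod N) :
    {g : FinTorusSite n₀ n₁ n₂ n₃ → Matrix.specialUnitaryGroup (Fin N) ℂ |
      ∃ c ∈ Subgroup.zpowers (suCenter N k : Matrix.specialUnitaryGroup (Fin N) ℂ), g = fun _ => c}.Finite := by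
  have h := (finite_zpowers_suCenter k).image fun c : Matrix.specialUnitaryGroup (Fin N) ℂ => fun _ : FinTorusSite n₀ n₁ n₂ n₃ => c
  refine h.subset ?_
  rintro g ⟨c, hc, rfl⟩
  exact ⟨c, hc, rfl⟩

/-- ★ **`hfix` (strong form): elements of `S` fix EVERY configuration.** [cite: Gonzalezarroyo1998, §4.2] -/
theorem gaugeAct_eq_self_of_mem_constCenterGauge {k : ZMod N} {s : FinTorusSite n₀ n₁ n₂ n₃ → Matrix.specialUnitaryGroup (Fin N) ℂ}
    (hs : s ∈ {g : FinTorusSite n₀ n₁ n₂ n₃ → Matrix.specialUnitaryGroup (Fin N) ℂ |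
      ∃ c ∈ Subgroup.zpowers (suCenter N k : Matrix.specialUnitaryGroup (Fin N) ℂ), g = fun _ => c})
    (U : FinTorusSite n₀ n₁ n₂ n₃ × Fin 4 → Matrix.specialUnitaryGroup (Fin N) ℂ) : gaugeAct s U = U := by
  obtain ⟨c, hc, rfl⟩ := hs
  have hcen : c ∈ Subgroup.center (Matrix.specialUnitaryGroup (Fin N) ℂ) :=
    (Subgroup.zpowers_le.mpr (suCenter N k).2) hc
  exact gaugeAct_const_of_mem_center hcen U

/-- ★ **`hstab`**: a gauge map fixing the decorated twist-eating ladder `ladderConfig ![A, B, ω^i·1, ω^j·1]` lies in `S`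
(K2 `gaugeAct_ladder_pair_eq_self_iff_specialUnitary`). [cite: Gonzalezarroyo1998, §4.2] -/
theorem mem_constCenterGauge_of_gaugeAct_ladder_eq [NeZero N] {k : ZMod N} (hk : IsUnit k) {A B : Matrix.specialUnitaryGroup (Fin N) ℂ}
    (hAB : B * A * B⁻¹ * A⁻¹ = (suCenter N k : Matrix.specialUnitaryGroup (Fin N) ℂ)) (i j : ZMod N)
    (g : FinTorusSite (m₀ + 1) (m₁ + 1) (m₂ + 1) (m₃ + 1) → Matrix.specialUnitaryGroup (Fin N) ℂ)
    (hg : gaugeAct g (ladderConfig ![A, B, (suCenter N i : Matrix.specialUnitaryGroup (Fin N) ℂ), (suCenter N j : Matrix.specialUnitaryGroup (Fin N) ℂ)]) =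
      ladderConfig ![A, B, (suCenter N i : Matrix.specialUnitaryGroup (Fin N) ℂ), (suCenter N j : Matrix.specialUnitaryGroup (Fin N) ℂ)]) :
    g ∈ {g : FinTorusSite (m₀ + 1) (m₁ + 1) (m₂ + 1) (m₃ + 1) → Matrix.specialUnitaryGroup (Fin N) ℂ |
      ∃ c ∈ Subgroup.zpowers (suCenter N k : Matrix.specialUnitaryGroup (Fin N) ℂ), g = fun _ => c} :=
  (gaugeAct_ladder_pair_eq_self_iff_specialUnitary hk hAB i j g).mp hg

end Stabiliser

/-! ## §3 The series logarithm near `1` on `SU(N)` -/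

section MatrixLog

/-- `log 1 = 0` for the series logarithm. [folklore] -/
theorem mlog_one_eq_zero : mlog (1 : Matrix (Fin N) (Fin N) ℂ) = 0 := by
  have h : mlog (exp (0 : Matrix (Fin N) (Fin N) ℂ)) = 0 := mlog_exp (by rw [norm_zero]; exact Real.log_pos one_lt_two)
  rwa [exp_zero] at h

/-- The series logarithm is continuous at every matrix within distance `1` of the identity. [folklore] -/
theorem continuousAt_mlog {W : Matrix (Fin N) (Fin N) ℂ} (hW : ‖W - 1‖ < 1) : ContinuousAt mlog W :=
  (analyticAt_mlog hW).continuousAt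

/-- ★ **The logarithm of a special unitary matrix near `1` is skew-Hermitian and traceless** (skew: Federbush's lemma on `‖W − 1‖ < 1/4`;
traceless: `e^{tr log W} = det W = 1` with `|tr log W| < 2π`). [cite: Helgason2000, Ch. I §1 Thm 1.14 p. 96] -/
theorem mlog_skew_traceless_of_mem_specialUnitaryGroup {W : Matrix (Fin N) (Fin N) ℂ} (hWsu : W ∈ Matrix.specialUnitaryGroup (Fin N) ℂ)
    (hW : ‖W - 1‖ < 1 / 4) (htr : ‖(mlog W).trace‖ < 2 * Real.pi) : (mlog W)ᴴ = -mlog W ∧ (mlog W).trace = 0 := by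
  have hWu : W ∈ Matrix.unitaryGroup (Fin N) ℂ := (Matrix.mem_specialUnitaryGroup_iff.1 hWsu).1
  have hW1 : ‖W - 1‖ < 1 := by linarith
  refine ⟨?_, ?_⟩
  · have h := star_mlog_of_mem_unitaryGroup hWu hW
    rwa [Matrix.star_eq_conjTranspose] at h
  · have hexp : exp (mlog W) = W := exp_mlog hW1
    have hdet : (exp (mlog W)).det = 1 := by rw [hexp]; exact (Matrix.mem_specialUnitaryGroup_iff.1 hWsu).2
    rw [det_exp_eq_exp_trace] at hdet
    have hC : Complex.exp (mlog W).trace = 1 := by rw [Complex.exp_eq_exp_ℂ]; exact hdet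
    obtain ⟨n, hn⟩ := Complex.exp_eq_one_iff.1 hC
    have h2π : ‖(2 * (Real.pi : ℂ) * Complex.I)‖ = 2 * Real.pi := by simp [abs_of_pos Real.pi_pos]
    have hnorm : ‖(mlog W).trace‖ = |(n : ℝ)| * (2 * Real.pi) := by rw [hn, norm_mul, Complex.norm_intCast, h2π]
    have hlt' : |(n : ℝ)| * (2 * Real.pi) < 1 * (2 * Real.pi) := by rw [← hnorm]; linarith
    have hn0 : |(n : ℝ)| < 1 := lt_of_mul_lt_mul_right hlt' (by positivity)
    have hn00 : n = 0 := by
      have h' : |n| < 1 := by exact_mod_cast hn0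
      exact Int.abs_lt_one_iff.mp h'
    rw [hn, hn00]
    simp

end MatrixLog

/-! ## §4 The exponential gauge chart is open at the origin; the transversal and the tube map are continuous -/

section Charts

variable [NeZero N]

omit [NeZero N] in
/-- `expGauge` is continuous. [folklore] -/
theorem continuous_expGauge : Continuous (expGauge : suFields N n₀ n₁ n₂ n₃ → FinTorusSite n₀ n₁ n₂ n₃ → Matrix.specialUnitaryGroup (Fin N) ℂ) := by
  letI : NormedAlgebra ℚ (Matrix (Fin N) (Fin N) ℂ) := NormedAlgebra.restrictScalars ℚ ℂ (Matrix (Fin N) (Fin N) ℂ)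
  refine continuous_pi fun x => Continuous.subtype_mk ?_ _
  exact exp_continuous.comp ((continuous_apply x).comp continuous_subtype_val)

omit [NeZero N] in
/-- `expGauge 0 = 1` (lit-4's `e 0 = 1`). [folklore] -/
theorem expGauge_zero : expGauge (0 : suFields N n₀ n₁ n₂ n₃) = 1 := by
  funext x; apply Subtype.ext
  rw [coe_expGauge_apply, ZeroMemClass.coe_zero, Pi.zero_apply, exp_zero]
  rfl

/-- ★★ **THE EXPONENTIAL GAUGE CHART IS OPEN AT THE ORIGIN**: `φ ↦ e^{φ}` maps every neighbourhood of `0 ∈ suFields` ONTO a neighbourhood of `1` in the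
gauge group `SU(N)^{sites}` — `𝓝 1 ≤ map expGauge (𝓝 0)` (local inverse `k ↦ (x ↦ log k(x))`, `𝔰𝔲(N)`-valued and continuous near `1`).  With any frame
`T_M : M ≃L suFields` the same holds for `e = expGauge ∘ T_M`. [cite: Helgason2000, Ch. I §1 Thm 1.14 p. 96] -/
theorem nhds_one_le_map_expGauge :
    𝓝 (1 : FinTorusSite n₀ n₁ n₂ n₃ → Matrix.specialUnitaryGroup (Fin N) ℂ) ≤
      map (expGauge : suFields N n₀ n₁ n₂ n₃ → FinTorusSite n₀ n₁ n₂ n₃ → Matrix.specialUnitaryGroup (Fin N) ℂ) (𝓝 0) := by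
  -- the projection of a site field onto `suFields` (a left inverse of the inclusion on `𝔰𝔲` data)
  set P : (FinTorusSite n₀ n₁ n₂ n₃ → Matrix (Fin N) (Fin N) ℂ) →L[ℝ] suFields N n₀ n₁ n₂ n₃ :=
    (ContinuousLinearMap.proj (0 : Fin 4)).comp ((suProj N n₀ n₁ n₂ n₃).comp
      (ContinuousLinearMap.pi fun _ : Fin 4 => ContinuousLinearMap.id ℝ (FinTorusSite n₀ n₁ n₂ n₃ → Matrix (Fin N) (Fin N) ℂ))) with hP
  have hPapply : ∀ (Φ : FinTorusSite n₀ n₁ n₂ n₃ → Matrix (Fin N) (Fin N) ℂ) (x : FinTorusSite n₀ n₁ n₂ n₃),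
      ((P Φ : suFields N n₀ n₁ n₂ n₃) : FinTorusSite n₀ n₁ n₂ n₃ → Matrix (Fin N) (Fin N) ℂ) x = skewTracelessPart N (Φ x) := by
    intro Φ x
    simp only [hP, ContinuousLinearMap.coe_comp, Function.comp_apply, ContinuousLinearMap.pi_apply, ContinuousLinearMap.coe_id', id_eq,
      ContinuousLinearMap.proj_apply, coe_suProj_apply]
  -- the local inverse `Λ k = P (x ↦ log ↑(k x))`
  set Λ : (FinTorusSite n₀ n₁ n₂ n₃ → Matrix.specialUnitaryGroup (Fin N) ℂ) → suFields N n₀ n₁ n₂ n₃ :=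
    fun k => P (fun x => mlog ((k x : Matrix.specialUnitaryGroup (Fin N) ℂ) : Matrix (Fin N) (Fin N) ℂ)) with hΛ
  have hcoe1 : ∀ x : FinTorusSite n₀ n₁ n₂ n₃,
      (((1 : FinTorusSite n₀ n₁ n₂ n₃ → Matrix.specialUnitaryGroup (Fin N) ℂ) x : Matrix.specialUnitaryGroup (Fin N) ℂ) :
        Matrix (Fin N) (Fin N) ℂ) = 1 := fun x => rfl
  have hlogc : ∀ x : FinTorusSite n₀ n₁ n₂ n₃, ContinuousAt (fun k : FinTorusSite n₀ n₁ n₂ n₃ → Matrix.specialUnitaryGroup (Fin N) ℂ =>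
      mlog ((k x : Matrix.specialUnitaryGroup (Fin N) ℂ) : Matrix (Fin N) (Fin N) ℂ)) 1 := by
    intro x
    have h1 : ContinuousAt (fun k : FinTorusSite n₀ n₁ n₂ n₃ → Matrix.specialUnitaryGroup (Fin N) ℂ =>
        ((k x : Matrix.specialUnitaryGroup (Fin N) ℂ) : Matrix (Fin N) (Fin N) ℂ)) 1 :=
      (continuous_subtype_val.comp (continuous_apply x)).continuousAt
    have h2 : ContinuousAt mlog (((1 : FinTorusSite n₀ n₁ n₂ n₃ → Matrix.specialUnitaryGroup (Fin N) ℂ) x :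
        Matrix.specialUnitaryGroup (Fin N) ℂ) : Matrix (Fin N) (Fin N) ℂ) := by
      rw [hcoe1]; exact continuousAt_mlog (by rw [sub_self, norm_zero]; exact one_pos)
    exact h2.comp_of_eq h1 (hcoe1 x)
  have hΛc : ContinuousAt Λ 1 := P.continuous.continuousAt.comp (continuousAt_pi.2 hlogc)
  have hΛ1 : Λ 1 = 0 := by
    simp only [hΛ, hcoe1, mlog_one_eq_zero]
    exact map_zero P
  -- the window: `‖↑(k x) − 1‖ < 1/4` and `‖tr log ↑(k x)‖ < 2π` at every site `x`
  have hwin : ∀ᶠ k in 𝓝 (1 : FinTorusSite n₀ n₁ n₂ n₃ → Matrix.specialUnitaryGroup (Fin N) ℂ), ∀ x,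
      ‖((k x : Matrix.specialUnitaryGroup (Fin N) ℂ) : Matrix (Fin N) (Fin N) ℂ) - 1‖ < 1 / 4 ∧
        ‖(mlog ((k x : Matrix.specialUnitaryGroup (Fin N) ℂ) : Matrix (Fin N) (Fin N) ℂ)).trace‖ < 2 * Real.pi := by
    refine Filter.eventually_all.2 fun x => Filter.Eventually.and ?_ ?_
    · have hc : ContinuousAt (fun k : FinTorusSite n₀ n₁ n₂ n₃ → Matrix.specialUnitaryGroup (Fin N) ℂ =>
          ‖((k x : Matrix.specialUnitaryGroup (Fin N) ℂ) : Matrix (Fin N) (Fin N) ℂ) - 1‖) 1 :=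
        ((continuous_subtype_val.comp (continuous_apply x)).sub continuous_const).norm.continuousAt
      have h0 : ‖(((1 : FinTorusSite n₀ n₁ n₂ n₃ → Matrix.specialUnitaryGroup (Fin N) ℂ) x : Matrix.specialUnitaryGroup (Fin N) ℂ) :
          Matrix (Fin N) (Fin N) ℂ) - 1‖ = 0 := by rw [hcoe1, sub_self, norm_zero]
      have ht := hc.tendsto
      rw [h0] at ht
      exact ht.eventually_lt_const (by norm_num)
    · have hc : ContinuousAt (fun k : FinTorusSite n₀ n₁ n₂ n₃ → Matrix.specialUnitaryGroup (Fin N) ℂ =>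
          ‖(mlog ((k x : Matrix.specialUnitaryGroup (Fin N) ℂ) : Matrix (Fin N) (Fin N) ℂ)).trace‖) 1 :=
        ((continuous_id.matrix_trace.continuousAt).comp (hlogc x)).norm
      have h0 : ‖(mlog (((1 : FinTorusSite n₀ n₁ n₂ n₃ → Matrix.specialUnitaryGroup (Fin N) ℂ) x : Matrix.specialUnitaryGroup (Fin N) ℂ) :
          Matrix (Fin N) (Fin N) ℂ)).trace‖ = 0 := by rw [hcoe1, mlog_one_eq_zero, Matrix.trace_zero, norm_zero]
      have ht := hc.tendsto
      rw [h0] at ht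
      exact ht.eventually_lt_const (by positivity)
  -- on the window, `expGauge (Λ k) = k`
  have hinv : ∀ᶠ k in 𝓝 (1 : FinTorusSite n₀ n₁ n₂ n₃ → Matrix.specialUnitaryGroup (Fin N) ℂ), expGauge (Λ k) = k := by
    refine hwin.mono fun k hk => ?_
    funext x; apply Subtype.ext
    rw [coe_expGauge_apply]
    obtain ⟨hskew, htr⟩ := mlog_skew_traceless_of_mem_specialUnitaryGroup (k x).2 (hk x).1 (hk x).2
    rw [hΛ, hPapply, skewTracelessPart_of_mem hskew htr]
    exact exp_mlog (by linarith [(hk x).1])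
  -- conclusion
  refine Filter.le_map fun s hs => ?_
  have hpre : Λ ⁻¹' s ∈ 𝓝 (1 : FinTorusSite n₀ n₁ n₂ n₃ → Matrix.specialUnitaryGroup (Fin N) ℂ) := hΛc (by rwa [hΛ1])
  filter_upwards [hpre, hinv] with k hk hkinv
  exact ⟨Λ k, hk, hkinv⟩

/-- ★ The same for the framed chart `e = expGauge ∘ T_M` of lit-4's `Θ'(z, y) = act (e z) (σ y)`: `𝓝 1 ≤ map e (𝓝 0)`.
[cite: Helgason2000, Ch. I §1 Thm 1.14 p. 96] -/
theorem nhds_one_le_map_expGauge_comp {M : Type*} [TopologicalSpace M] [AddCommMonoid M] [Module ℝ M] (T_M : M ≃L[ℝ] suFields N n₀ n₁ n₂ n₃) :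
    𝓝 (1 : FinTorusSite n₀ n₁ n₂ n₃ → Matrix.specialUnitaryGroup (Fin N) ℂ) ≤ map (fun z : M => expGauge (T_M z)) (𝓝 0) := by
  have h : map (fun z : M => expGauge (T_M z)) (𝓝 0) = map (expGauge : suFields N n₀ n₁ n₂ n₃ → _) (map T_M (𝓝 (0 : M))) := by
    rw [Filter.map_map]; rfl
  have hT : map T_M (𝓝 (0 : M)) = 𝓝 (T_M 0) := T_M.toHomeomorph.map_nhds_eq 0
  rw [h, hT, map_zero]
  exact nhds_one_le_map_expGauge

variable {L : FinTorusSite n₀ n₁ n₂ n₃ × Fin 4 → Matrix (Fin N) (Fin N) ℂ}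

omit [NeZero N] in
/-- The transversal `y ↦ e^{y}·L` is continuous. [folklore] -/
theorem continuous_sliceCfg (hL : ∀ e, L e ∈ Matrix.specialUnitaryGroup (Fin N) ℂ) : Continuous (sliceCfg hL) := by
  letI : NormedAlgebra ℚ (Matrix (Fin N) (Fin N) ℂ) := NormedAlgebra.restrictScalars ℚ ℂ (Matrix (Fin N) (Fin N) ℂ)
  refine continuous_pi fun e => Continuous.subtype_mk ?_ _
  show Continuous fun y : realCoulombSlice L => exp ((y : Fin 4 → FinTorusSite n₀ n₁ n₂ n₃ → Matrix (Fin N) (Fin N) ℂ) e.2 e.1) * L e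
  have h1 : Continuous fun y : realCoulombSlice L => (y : Fin 4 → FinTorusSite n₀ n₁ n₂ n₃ → Matrix (Fin N) (Fin N) ℂ) e.2 e.1 :=
    (continuous_apply e.1).comp ((continuous_apply e.2).comp continuous_subtype_val)
  exact (exp_continuous.comp h1).mul continuous_const

omit [NeZero N] in
/-- ★ **The tube map `(k, y) ↦ k • σ(T_V y)` is jointly continuous** (lit-4 `Θ`; with L17 §5 `measurableSet_image_prod_of_isCompact` ∕ L21 §3b
`exists_pos_forall_act_ne`). [cite: Bredon1972, Ch. II §§4–5] -/
theorem continuous_tubeMap (hL : ∀ e, L e ∈ Matrix.specialUnitaryGroup (Fin N) ℂ) {V : Type*} [TopologicalSpace V] [AddCommMonoid V] [Module ℝ V]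
    (T_V : V ≃L[ℝ] realCoulombSlice L) :
    Continuous fun p : (FinTorusSite n₀ n₁ n₂ n₃ → Matrix.specialUnitaryGroup (Fin N) ℂ) × V => gaugeAct p.1 (sliceCfg hL (T_V p.2)) := by
  have hσ : Continuous fun p : (FinTorusSite n₀ n₁ n₂ n₃ → Matrix.specialUnitaryGroup (Fin N) ℂ) × V => sliceCfg hL (T_V p.2) :=
    (continuous_sliceCfg hL).comp (T_V.continuous.comp continuous_snd)
  refine continuous_pi fun e => ?_
  simp only [gaugeAct]
  exact ((((continuous_apply e.1).comp continuous_fst).mul ((continuous_apply e).comp hσ)).mul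
    (((continuous_apply (e.1.shift e.2)).comp continuous_fst).inv))

end Charts

/-! ## §5 The background: the matrix ladder as an `SU(N)` configuration, a zero of the exponent -/

section Background

variable [NeZero N] {m₀ m₁ m₂ m₃ : ℕ}

omit [NeZero N] in
/-- The links of the decorated matrix ladder `ladderField ![A, B, ω^i•1, ω^j•1]` are special unitary. [folklore] -/
theorem ladderFieldPair_mem_specialUnitaryGroup (A B : Matrix.specialUnitaryGroup (Fin N) ℂ) (i j : ZMod N) (e : FinTorusSite n₀ n₁ n₂ n₃ × Fin 4) :
    ladderField ![(A : Matrix (Fin N) (Fin N) ℂ), (B : Matrix (Fin N) (Fin N) ℂ), centerPhase N i • (1 : Matrix (Fin N) (Fin N) ℂ),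
      centerPhase N j • (1 : Matrix (Fin N) (Fin N) ℂ)] e ∈ Matrix.specialUnitaryGroup (Fin N) ℂ := by
  rw [← coe_ladderConfig_pair]
  exact (ladderConfig ![A, B, (suCenter N i : Matrix.specialUnitaryGroup (Fin N) ℂ), (suCenter N j : Matrix.specialUnitaryGroup (Fin N) ℂ)] e).2

omit [NeZero N] in
/-- ★ **The `SU(N)`-valued configuration of the matrix ladder IS K2's decorated ladder** `ladderConfig ![A, B, ω^i·1, ω^j·1]`. [folklore] -/
theorem mk_ladderFieldPair_eq_ladderConfig (A B : Matrix.specialUnitaryGroup (Fin N) ℂ) (i j : ZMod N)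
    (hL : ∀ e : FinTorusSite n₀ n₁ n₂ n₃ × Fin 4, ladderField ![(A : Matrix (Fin N) (Fin N) ℂ), (B : Matrix (Fin N) (Fin N) ℂ),
      centerPhase N i • (1 : Matrix (Fin N) (Fin N) ℂ), centerPhase N j • (1 : Matrix (Fin N) (Fin N) ℂ)] e ∈ Matrix.specialUnitaryGroup (Fin N) ℂ) :
    (fun e => (⟨ladderField ![(A : Matrix (Fin N) (Fin N) ℂ), (B : Matrix (Fin N) (Fin N) ℂ), centerPhase N i • (1 : Matrix (Fin N) (Fin N) ℂ),
      centerPhase N j • (1 : Matrix (Fin N) (Fin N) ℂ)] e, hL e⟩ : Matrix.specialUnitaryGroup (Fin N) ℂ)) =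
      ladderConfig ![A, B, (suCenter N i : Matrix.specialUnitaryGroup (Fin N) ℂ), (suCenter N j : Matrix.specialUnitaryGroup (Fin N) ℂ)] := by
  funext e; apply Subtype.ext
  exact (congrFun (coe_ladderConfig_pair (n₀ := n₀) (n₁ := n₁) (n₂ := n₂) (n₃ := n₃) A B i j) e).symm

omit [NeZero N] in
/-- `σ 0` is the decorated ladder. [folklore] -/
theorem sliceCfg_zero_eq_ladderConfig (A B : Matrix.specialUnitaryGroup (Fin N) ℂ) (i j : ZMod N)
    (hL : ∀ e : FinTorusSite n₀ n₁ n₂ n₃ × Fin 4, ladderField ![(A : Matrix (Fin N) (Fin N) ℂ), (B : Matrix (Fin N) (Fin N) ℂ),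
      centerPhase N i • (1 : Matrix (Fin N) (Fin N) ℂ), centerPhase N j • (1 : Matrix (Fin N) (Fin N) ℂ)] e ∈ Matrix.specialUnitaryGroup (Fin N) ℂ) :
    sliceCfg hL 0 = ladderConfig ![A, B, (suCenter N i : Matrix.specialUnitaryGroup (Fin N) ℂ), (suCenter N j : Matrix.specialUnitaryGroup (Fin N) ℂ)] := by
  rw [sliceCfg_zero]; exact mk_ladderFieldPair_eq_ladderConfig A B i j hL

/-- ★ **The decorated ladder is a zero of the exponent** (K9 `twistedExponent_eq_zero_iff` with the trivial gauge map). [cite: Gonzalezarroyo1998, §4.2] -/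
theorem twistedExponent_ladderConfig_pair {k : ZMod N} (hk : IsUnit k) {A B : Matrix.specialUnitaryGroup (Fin N) ℂ}
    (hAB : B * A * B⁻¹ * A⁻¹ = (suCenter N k : Matrix.specialUnitaryGroup (Fin N) ℂ)) (i j : ZMod N) :
    twistedExponent k (ladderConfig ![A, B, (suCenter N i : Matrix.specialUnitaryGroup (Fin N) ℂ), (suCenter N j : Matrix.specialUnitaryGroup (Fin N) ℂ)] :
      FinTorusSite (m₀ + 1) (m₁ + 1) (m₂ + 1) (m₃ + 1) × Fin 4 → Matrix.specialUnitaryGroup (Fin N) ℂ) = 0 :=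
  (twistedExponent_eq_zero_iff hk hAB _).2 ⟨1, i, j, (gaugeAct_one _).symm⟩

/-- ★ **The exponent at the matrix-ladder background vanishes** (the `hU` input of K19 `sliceHessian_pos` ∕ `isLittleO_slicePhase_taylor_two` at `U = σ 0`).
[cite: Gonzalezarroyo1998, §4.2] -/
theorem twistedExponent_mk_ladderFieldPair {k : ZMod N} (hk : IsUnit k) {A B : Matrix.specialUnitaryGroup (Fin N) ℂ}
    (hAB : B * A * B⁻¹ * A⁻¹ = (suCenter N k : Matrix.specialUnitaryGroup (Fin N) ℂ)) (i j : ZMod N)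
    (hL : ∀ e : FinTorusSite (m₀ + 1) (m₁ + 1) (m₂ + 1) (m₃ + 1) × Fin 4, ladderField ![(A : Matrix (Fin N) (Fin N) ℂ), (B : Matrix (Fin N) (Fin N) ℂ),
      centerPhase N i • (1 : Matrix (Fin N) (Fin N) ℂ), centerPhase N j • (1 : Matrix (Fin N) (Fin N) ℂ)] e ∈ Matrix.specialUnitaryGroup (Fin N) ℂ) :
    twistedExponent k (fun e => (⟨ladderField ![(A : Matrix (Fin N) (Fin N) ℂ), (B : Matrix (Fin N) (Fin N) ℂ), centerPhase N i • (1 : Matrix (Fin N) (Fin N) ℂ),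
      centerPhase N j • (1 : Matrix (Fin N) (Fin N) ℂ)] e, hL e⟩ : Matrix.specialUnitaryGroup (Fin N) ℂ)) = 0 := by
  rw [mk_ladderFieldPair_eq_ladderConfig]; exact twistedExponent_ladderConfig_pair hk hAB i j

end Background

end Summit.QuantumFields.YangMills.Cruxes.IRcof.TwistedSlab

end
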